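import Literature.MathematicalPhysics.QuantumFieldTheory.Balaban1983to89.B16SmallCouplings
import Literature.MathematicalPhysics.QuantumFieldTheory.Balaban1983to89.B16TstarCount
import Literature.MathematicalPhysics.QuantumFieldTheory.Balaban1983to89.B16ZLower

/-!
# `Balaban1983to89.B16LeafFamily` (v1) — the leaf family of `B16SmallCouplings.not_uvBound01_of_leaves`
INSTANTIATED from the series' own data: periodic lattices, the (1.15) [III] one-step constants verbatim, the (0.15) [I]
normalisation on SU(N); fifteen bookkeeping hypotheses of the v1.1 headline DISCHARGED by definitions

CITATION HEADER (lean-in-tree rule 2026-08-18).  Sources: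
(B12 = [I]) T. Bałaban, *Renormalization group approach to lattice gauge field theories. I. Generation of effective
actions in a small field approximation and a coupling constant renormalization in four dimensions*, Commun. Math.
Phys. **109**, 249–301 (1987), doi:10.1007/bf01215223, bib `Balaban1987RG1` (held:
`paper:balaban1987-cmp109-rg-i-small-field`; journal page = PDF page + 248);
(B14 = [III]) T. Bałaban, *Convergent renormalization expansions for lattice gauge theories*, Commun. Math. Phys.
**119**, 243–285 (1988), doi:10.1007/bf01217741, bib `Balaban1988Convergent` (held:
`paper:balaban1988-cmp119-convergent-renormalization`; journal page = PDF page + 242);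
(B16) T. Bałaban, *Large field renormalization. II. Localization, exponentiation, and bounds for the R operation*,
Commun. Math. Phys. **122**, 355–392 (1989), doi:10.1007/bf01238433, bib `Balaban1989LargeFieldII`.  The quotations
below were READ AS IMAGES on the x2 page renders of the cell (`run/shared/lean/pub/pub-balaban/b2b-balaban-ref1/pages/`:
`1987-cmp109-rg-I-small-field/1987-cmp109-rg-I-small-field-p003-x2.png` = [I] p. 251;
`1988-cmp119-convergent-renormalization/1988-cmp119-convergent-renormalization-p007-x2.png`, `…-p012-x2.png`,
`…-p020-x2.png` = [III] pp. 249, 254, 262), not on an OCR layer: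

* [I] p. 251 [3], (0.1): *"Define the initial lattice approximation on the torus
  T_ε = {x ∈ εZ^d + Σ_{μ=1}^{d} ½εe_μ : −L_μ < x_μ < L_μ, μ = 1, …, d},   (0.1)
  with a lattice spacing ε = L^{−K}. This torus determines a sequence of tori denoted by T^{(k)}_{L^kε} and defined by
  (0.1) with ε replaced by L^kε, k = 1, 2, … ."* with *"We take L_μ = L^m, where L is an odd, positive integer > 11,
  and m is a positive integer."* — so T^{(k)} has `2·L^{m+K−k}` sites per direction (the cell's `Setup.sitesPerDir`,
  cell DIVERGENCE.md row F2), `|T₁^{(k)}| = (2L^{m+K−k})⁴` in d = 4 (the `B12.RunData` docstring of the sibling `B12`: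
  *"`numSites k` = |T_1^{(k)}| (in the model: `Fintype.card (Setup.Site P k) = (2L^{m+K-k})^d`)"*).
* [III] p. 249 [7], (1.15), first exponential: *"·exp[−(1/g₀²)A(U₁) + log g₀ d(𝐠)|Ω₁*| + log σ₀|Ω₁*|
  − log z(L⁴ − 1)|Ω₁^{(1)}| − E]"* and, same page: *"The number |Ω₁*| is the number of bonds belonging to Ω₁ minus the
  number of bonds in the set {b₀(c) : c ∈ Ω₁^{(1)}}."*
* [III] p. 254 [12]: *"The constant E₁ is obtained from E by subtraction of all the constants which have appeared in the
  procedure, i.e., the constants in the first exponential in (1.15), and the constant E^{(1)}(Λ₁, g₀, 1). Thus E₁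
  depends on Ω₁, Λ₁."*
* [III] p. 262 [20]: *"This initial constant is defined in fact as a sum of all such expressions for all the lattices
  T^{(k)} as the small field regions."* and Theorem 1, same page: *"… the sequence of densities {ρ_k}, generated by
  successive applications of the operations 𝐑𝐓 to the density ρ₀ = exp[−(1/g₀²)A − E], satisfies all the inductive
  assumptions."*
* [I] (0.15) p. 254 / p. 255 l. 1 (the gauge-fixing normalisation z, *"where z is defined by the last integral"*) and
  [I] (2.13)–(2.14) p. 268 (`log N″_k = E^{(k+1)}(g_k, 1)`) are used only through the siblings' TYPED objects
  `B16ZLower.zNorm` and `B16B10Shape.CountertermData.Efl` / `EflBound` and are quoted there.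

WHAT THIS MODULE DOES (audit cell `pub-balaban`, unit `b2b-balaban-pv24-g5` = SURGE NODE PROVER #24 gen 5, owner
lineage of `B16B10Shape` / `B16ZLower` / `B16TstarCount` / `B16SmallCouplings`; journal row LEAFFAMILY-KERNEL; value =
a KERNEL CERTIFICATE — bookkeeping hypotheses of a landed refutation-shape theorem discharged by definitions —, NOT
summit progress; nothing of the series is asserted).  The sibling `B16SmallCouplings` (v1.1 §5) proves
`not_uvBound01_of_leaves`: the constant-exponent reading (B) `B16.UVBound01 C` of B16 (0.1) FAILS for a
forward-generated `B16.Construction` with β bounded above, GIVEN an abstract family `S P : B16B10Shape.CountertermData`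
of per-run carriers tied to the run by a dictionary and satisfying the located leaves — 25 hypotheses, of which 15 are
schematic bookkeeping about `S` (`hL hdg hσ hK hN0 hgd h115 hsum hT hB hN hz h2L hdg1 hCz`) and one (`hNpos`) is the
non-emptiness of the lattices.  Here the family is BUILT from the series' data (§1–§2) and those hypotheses are PROVED
(§3), so that the headline (§4) keeps ten hypotheses, all located inputs:

* §1 — the lattice numbers of a run `P = (K, m, g₀)` for a block size `L`: `nn L P j = 2·L^{m+K−j}` sites per
  direction of T^{(j)} ((0.1) [I]); the site number in the CLOSED FORM `sitesR L P j = 16·(L⁴)^{m+K}/(L⁴)^j` (a real;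
  `= (2L^{m+K−j})⁴ = |T₁^{(j)}|` for `j ≤ m + K`, `sitesR_eq_pow`; the closed form makes the blocking identity
  `N(j+1)·L⁴ = N j` hold at EVERY j, as the sibling's leaf `Blocking` is typed); `|Ω*|` at scale j as the bond count
  `card (starBonds b₀)` of `B16TstarCount` §2 on the blocked torus `(ℤ/nn j)⁴ → (ℤ/nn (j+1))⁴` (offset `(L − 1)/2`).
* §2 — the carrier `carrier I P g Efl : CountertermData` of a run with coupling sequence `g` and fluctuation constants
  `Efl j = E^{(j+1)}(T^{(j+1)}, g_j, 1)` (an ABSTRACT real family — the object of the OPEN reader's item `EflBound`,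
  author question (ii) of cell GAPS G-pv24-1): `K := P.K`, `N := sitesR`, `dg := N² − 1 = d(𝔰𝔲(N))`, `L`, `log σ₀`,
  `Tstar := |Ω*|`, `logz j := log z(g_j², ε₀)` on SU(N) (`B16ZLower.zNorm`, (0.15) [I] at α = g_j²),
  `e j :=` the first-exponential constants of (1.15) [III] at scale j VERBATIM plus `E^{(j+1)}(T^{(j+1)}, g_j, 1)`
  (p. 254), `E := Σ_{j<K} e j` (p. 262); `leafFamily I C Efl P := carrier I P (C P).flow.g (Efl P)`.
* §3 — DISCHARGE: `OneStep115`, `ESum`, the dictionary clauses `L`/`dg`/`logσ₀`/`K`/`g` hold by `rfl`; `Blocking` and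
  `0 ≤ N j` by real arithmetic; `TstarCount` by `B16TstarCount.tstarCount_of_torus`; `ZLower (C_z^{SU}(N, ε₀))` by
  `B16ZLower.zLower_of_specialUnitaryGroup` on the runs of a ]0, γ₁]-family with `γ₁ ≤ 1`; `N 0 = |T₁^{(0)}|` and
  `0 < |T₁^{(0)}|` from ONE lattice-size dictionary clause `(C P).numSites 0 = (2L^{m+K})⁴` on the abstract
  construction; `1 ≤ d(𝔤)` from `N ≥ 2`; `0 ≤ 4|log σ₀| + C_z` from `B16ZLower.CzSU_nonneg`.
* §4 — HEADLINE `not_uvBound01_of_torusLeaves`: for `G = SU(N)` (N ≥ 2), block size `L ≥ 2`, `ε₀ > 0`, the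
  constant-exponent reading (B) `B16.UVBound01 C` FAILS for every `B16.Construction` that is forward generated by
  (0.20) with a history β-family bounded above on some box family (as in the sibling), whose step-0 lattices are the
  tori of (0.1) (`numSites 0 = (2L^{m+K})⁴`), and which on the runs of ONE ]0, γ₁]-family (0 < γ₁ ≤ 1) with at least
  one step satisfies (iii) the NORMALISATION LEAF of [III] Thm 1 p. 262 — some step-0 configuration has
  `ρ₀ ≥ e^{−E}` with `E` NOW THE EXPLICIT PRINTED SUM `leafE` of the (1.15) constants — and (iv) the reader's item
  `EflBound`: `E^{(j+1)}(T^{(j+1)}, g_j, 1) ≤ C_E·|T₁^{(j+1)}|` (C_E ≥ 0; OPEN, no printed bound exists — G-pv24-1a).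
  Companion `logNormalisedFrom_one_of_torusLeaves` (the K₀ = 1 logarithm with the explicit constants
  `3(1 − L⁻⁴)(N² − 1)` and `4|log σ₀| + C_z^{SU}(N, ε₀) + C_E/(L⁴ − 1)`).
* §5 — NON-VACUITY: a toy construction (`toyTorus`: couplings generated by (0.20) as in the sibling's `toyModel`, the
  lattice numbers of (0.1), `ρ_k ≡ e^{−E}`) satisfies every hypothesis of the headline at once with the zero β-family,
  `Efl ≡ 0`, `C_E = 0` (`toyTorus_headline_hypotheses`) — the instantiated theorem has content.

SCOPE, stated honestly.  This file decides nothing about Bałaban's densities: after it, `¬(B)` for the series rests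
on exactly (i) the flow clauses (forward generation [I] (0.17)–(0.20) — a modelling clause of the cell — and the printed
upper β-bound [I] p. 264), (ii) the lattice-size clause ((0.1) [I]), (iii) the Thm 1 p. 262 normalisation leaf read at
the unit configuration with [III]'s bookkeeping of E (pp. 254, 262) — a located leaf, never asserted here —, and
(iv) the OPEN reader's item `EflBound` (author question (ii), cell GAPS G-pv24-1 / G-pv24-1a: the located support is
[I] (2.13)–(2.14), `log N″_k = E^{(k+1)}(g_k, 1)`, a normalised Gaussian expectation; NO printed statement bounds it).
The group is SU(N) because `ZLower` is proved there (`B16ZLower`; B12 Thm 2 is SU(2)); U(N) would go the same way with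
`B16ZLower.zLower_of_unitaryGroup` and `dg = N²`.  `L ≥ 2` is what the arithmetic needs (the series: L odd > 11).

ABSOLUTE RULE.  No internally-minted statement enters as a cited fact: every `theorem` below is kernel-proved from
Mathlib and the siblings' DEFINITIONS and THEOREMS; the new `def`s TRANSCRIBE printed formulas ((0.1) [I] site numbers,
(1.15) [III] constants, E = Σ of p. 262) into the sibling's carrier; every remaining hypothesis of the headline is a
located leaf, a labelled OPEN reader's item, or a modelling clause of the cell, each named above; the toy of §5 is a
model, not a claim about the series; the papers' disputed steps are not used.  Imports `B16SmallCouplings` (hence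
`FlowStepRuns`, `FlowStep`, `DagBinding`, `B16B10Shape`, `B16`, `B12`), `B16TstarCount`, `B16ZLower`; restates nothing
of them.  Mathlib only otherwise; no `sorry` / `axiom`.  Companion: GAPS row C-pv24g5-1, journal CLAIMS.log
`LEAFFAMILY-KERNEL`, HANDOFF.md § b2b-balaban-pv24 gen 5.
-/

open scoped BigOperators

namespace Literature.MathematicalPhysics.QuantumFieldTheory.Balaban1983to89

namespace B16LeafFamily

open FlowStep (HBeta prefixOf BetaUpperH)
open DagBinding (ForwardGenerated)
open B16B10Shape (CountertermData)
open B16TstarCount (starBonds b0 tstarCount_of_torus)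
open B16ZLower (zNorm CzSU CzSU_nonneg zLower_of_specialUnitaryGroup)
open B16SmallCouplings (LogNormalisedFrom logNormalisedFrom_one_of_leaves not_uvBound01_of_leaves)
open FlowStepRuns (solveCoupling_pos inv_sq_solveCoupling genSeq genSeq_zero genSeq_succ genFlow)

/-! ## §1. Lattice numbers of a run: sites per direction, site numbers in closed form, the bond count |Ω*| -/

/-- INPUT CONSTANTS of the instantiation (fixed inside a construction, [III] Thm 1 / [I] Thm 3): block size `L ≥ 2`
([I] p. 251: *"L is an odd, positive integer > 11"*), the group `SU(N)`, `N ≥ 2` (so `d(𝔤) = N² − 1 ≥ 1`), the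
small-field parameter `ε₀ > 0` of (0.15) [I], and `log σ₀` ((2.8) [I], the constant of (1.15) [III]).
Reader-chosen packaging. [cite: Balaban1987RG1, (0.1) p.251] -/
structure LeafInput where
  L : ℕ
  N : ℕ
  ε₀ : ℝ
  logσ₀ : ℝ
  hL : 2 ≤ L
  hN : 2 ≤ N
  hε₀ : 0 < ε₀

/-- `N ≠ 0` for the group index (from `N ≥ 2`), as an instance for `Fin N` / `SU(N)`. [folklore] -/
instance (I : LeafInput) : NeZero I.N := ⟨by have := I.hN; omega⟩

/-- Sites per direction of T^{(j)} for the run `P = (K, m, g₀)`: `2·L^{m+K−j}` ((0.1) [I] with ε ↦ L^jε; the cell's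
`Setup.sitesPerDir`, DIVERGENCE F2; meaningful for `j ≤ m + K`). [cite: Balaban1987RG1, (0.1) p.251] -/
def nn (L : ℕ) (P : B12.RunParams) (j : ℕ) : ℕ := 2 * L ^ (P.m + P.K - j)

/-- The site count per direction is nonzero for `L ≥ 2`. [folklore] -/
instance (I : LeafInput) (P : B12.RunParams) (j : ℕ) : NeZero (nn I.L P j) :=
  ⟨mul_ne_zero two_ne_zero (pow_ne_zero _ (by have := I.hL; omega))⟩

/-- One blocking step in the site count: `nn j = L · nn (j+1)` for `j < K` (indeed for `j < m + K`). [folklore] -/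
theorem nn_eq_mul_succ (L : ℕ) (P : B12.RunParams) {j : ℕ} (hj : j < P.K) : nn L P j = L * nn L P (j + 1) := by
  unfold nn
  rw [show P.m + P.K - j = (P.m + P.K - (j + 1)) + 1 by omega, pow_succ]
  ring

/-- `|T₁^{(j)}|` in CLOSED FORM: `16·(L⁴)^{m+K}/(L⁴)^j` (a real number; equals `(2L^{m+K−j})⁴` for `j ≤ m + K`,
`sitesR_eq_pow`; the closed form continues the blocking identity to every `j`). [cite: Balaban1987RG1, (0.1) p.251] -/
noncomputable def sitesR (L : ℕ) (P : B12.RunParams) (j : ℕ) : ℝ :=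
  16 * ((L : ℝ) ^ 4) ^ (P.m + P.K) / ((L : ℝ) ^ 4) ^ j

/-- Site numbers are non-negative. [folklore] -/
theorem sitesR_nonneg (L : ℕ) (P : B12.RunParams) (j : ℕ) : 0 ≤ sitesR L P j := by
  unfold sitesR
  positivity

/-- BLOCKING at every scale: `|T₁^{(j+1)}|·L⁴ = |T₁^{(j)}|` for the closed form (`L ≠ 0`). [folklore] -/
theorem sitesR_succ_mul (I : LeafInput) (P : B12.RunParams) (j : ℕ) :
    sitesR I.L P (j + 1) * (I.L : ℝ) ^ 4 = sitesR I.L P j := by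
  have hL : (I.L : ℝ) ≠ 0 := by
    have := I.hL
    exact_mod_cast (show I.L ≠ 0 by omega)
  unfold sitesR
  field_simp
  ring

/-- The closed form IS the site number `(2L^{m+K−j})⁴` in the meaningful range `j ≤ m + K`. [folklore] -/
theorem sitesR_eq_pow (I : LeafInput) (P : B12.RunParams) {j : ℕ} (hj : j ≤ P.m + P.K) :
    sitesR I.L P j = (((nn I.L P j) ^ 4 : ℕ) : ℝ) := by
  obtain ⟨t, ht⟩ := Nat.exists_eq_add_of_le hj
  have hL : (I.L : ℝ) ≠ 0 := by
    have := I.hL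
    exact_mod_cast (show I.L ≠ 0 by omega)
  have hB : ((I.L : ℝ) ^ 4) ^ j ≠ 0 := pow_ne_zero _ (pow_ne_zero _ hL)
  unfold sitesR nn
  rw [ht, Nat.add_sub_cancel_left, pow_add]
  field_simp
  push_cast
  ring

/-- The site number is positive. [folklore] -/
theorem sitesR_pos (I : LeafInput) (P : B12.RunParams) (j : ℕ) : 0 < sitesR I.L P j := by
  have hL : (0 : ℝ) < (I.L : ℝ) := by
    have := I.hL
    exact_mod_cast (show 0 < I.L by omega)
  unfold sitesR
  positivity

/-- `|Ω*|` at scale j for Ω = the whole lattice: the number of bonds of T^{(j)} = (ℤ/nn j)⁴ minus the number of bonds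
`b₀(c)`, c a bond of T^{(j+1)} = (ℤ/nn (j+1))⁴ — the bond count `card (starBonds b₀)` of `B16TstarCount` §2 for its
explicit `b₀` (offset `(L − 1)/2`), as a real. [cite: Balaban1988Convergent, (1.15) p.249] -/
noncomputable def tstar (I : LeafInput) (P : B12.RunParams) (j : ℕ) : ℝ :=
  ((starBonds (b0 (d := 4) (m := nn I.L P (j + 1)) I.L (nn I.L P j) ((I.L - 1) / 2))).card : ℝ)

/-! ## §2. The carrier of a run: the (1.15) [III] constants verbatim, E = their sum -/

/-- `log z` at scale j on `SU(N)`: the logarithm of the (0.15) [I] normalisation `z(α, ε₀)` at `α = g_j²`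
(`B16ZLower.zNorm`, a transcription of the printed definition). [cite: Balaban1987RG1, (0.15) p.254] -/
noncomputable def logz (I : LeafInput) (g : ℕ → ℝ) (j : ℕ) : ℝ :=
  Real.log (zNorm (Matrix.specialUnitaryGroup (Fin I.N) ℂ) (g j ^ 2) I.ε₀)

/-- THE ONE-STEP VACUUM-ENERGY EXPRESSION at scale j, VERBATIM from the first exponential of (1.15) [III] p. 249 with
Ω₁ = the whole lattice T^{(j)} (*"+ log g₀ d(𝐠)|Ω₁*| + log σ₀|Ω₁*| − log z(L⁴ − 1)|Ω₁^{(1)}|"*) PLUS the constant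
`E^{(j+1)}(T^{(j+1)}, g_j, 1)` (p. 254: E₁ = E minus *"the constants in the first exponential in (1.15), and the
constant E^{(1)}(Λ₁, g₀, 1)"*): `log g_j·d(𝔤)·|Ω*| + log σ₀·|Ω*| − log z·(L⁴ − 1)|T₁^{(j+1)}| + Efl j`, typed in the
exact shape of the sibling's leaf `CountertermData.OneStep115`. [cite: Balaban1988Convergent, (1.15) p.249] -/
noncomputable def eStep (I : LeafInput) (P : B12.RunParams) (g Efl : ℕ → ℝ) (j : ℕ) : ℝ :=
  Real.log (g j) * ((I.N * I.N - 1 : ℕ) : ℝ) * tstar I P j + I.logσ₀ * tstar I P j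
    - logz I g j * (((I.L : ℝ) ^ 4 - 1) * sitesR I.L P (j + 1)) + Efl j

/-- THE INITIAL CONSTANT E of ρ₀ = exp[−(1/g₀²)A − E] ([III] Thm 1 p. 262): *"defined in fact as a sum of all such
expressions for all the lattices T^{(k)} as the small field regions"* — `E = Σ_{j<K} eStep j`. [cite: Balaban1988Convergent, Thm 1 p.262] -/
noncomputable def leafE (I : LeafInput) (P : B12.RunParams) (g Efl : ℕ → ℝ) : ℝ :=
  ∑ j ∈ Finset.range P.K, eStep I P g Efl j

/-- THE CARRIER of the run `P` with coupling sequence `g` and fluctuation constants `Efl`: the sibling's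
`CountertermData` with `K := P.K`, `N := |T₁^{(·)}|` (closed form), `g`, `dg := N² − 1`, `L`, `log σ₀`, `Tstar := |Ω*|`,
`logz`, `Efl`, `e := eStep`, `E := leafE`.  Definitions only. [cite: Balaban1988Convergent, (1.15) p.249] -/
noncomputable def carrier (I : LeafInput) (P : B12.RunParams) (g Efl : ℕ → ℝ) : CountertermData where
  K := P.K
  N := sitesR I.L P
  g := g
  dg := I.N * I.N - 1
  L := I.L
  logσ₀ := I.logσ₀
  Tstar := tstar I P
  logz := logz I g
  Efl := Efl
  e := eStep I P g Efl
  E := leafE I P g Efl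

/-- THE LEAF FAMILY of a `B16.Construction`: run by run, the carrier of the construction's own coupling sequence
`(C P).flow.g` and of the fluctuation constants `Efl P`. [folklore] -/
noncomputable def leafFamily (I : LeafInput) (C : B16.Construction) (Efl : B12.RunParams → ℕ → ℝ)
    (P : B12.RunParams) : CountertermData :=
  carrier I P (C P).flow.g (Efl P)

/-! ## §3. Discharge of the bookkeeping hypotheses of `B16SmallCouplings.not_uvBound01_of_leaves` -/

section Discharge

variable (I : LeafInput) (P : B12.RunParams) (g Efl : ℕ → ℝ)

/-- (1.15) holds for the carrier BY DEFINITION of `eStep`. [folklore] -/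
theorem carrier_oneStep115 : (carrier I P g Efl).OneStep115 := fun _ _ => rfl

/-- `E = Σ_{j<K} e j` holds for the carrier BY DEFINITION of `leafE`. [folklore] -/
theorem carrier_eSum : (carrier I P g Efl).ESum := rfl

/-- Blocking `|T₁^{(j+1)}|·L⁴ = |T₁^{(j)}|` at every j (closed form). [folklore] -/
theorem carrier_blocking : (carrier I P g Efl).Blocking := fun j => sitesR_succ_mul I P j

/-- Site numbers of the carrier are non-negative. [folklore] -/
theorem carrier_N_nonneg (j : ℕ) : 0 ≤ (carrier I P g Efl).N j := sitesR_nonneg I.L P j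

/-- `TstarCount` (`|Ω*| = 4|T₁^{(j)}| − 4|T₁^{(j+1)}|`, j < K) holds for the carrier — by the sibling's
`B16TstarCount.tstarCount_of_torus` on the tori `(ℤ/2L^{m+K−j})⁴ → (ℤ/2L^{m+K−j−1})⁴`. [folklore] -/
theorem carrier_tstarCount : (carrier I P g Efl).TstarCount :=
  tstarCount_of_torus (carrier I P g Efl) (nn I.L P) (fun j => nn I.L P (j + 1)) ((I.L - 1) / 2)
    (fun j hj => nn_eq_mul_succ I.L P hj)
    (by have := I.hL; show (I.L - 1) / 2 < I.L; omega)
    (fun j hj => sitesR_eq_pow I P (by show j ≤ P.m + P.K; have : j < P.K := hj; omega))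
    (fun j hj => sitesR_eq_pow I P (by show j + 1 ≤ P.m + P.K; have : j < P.K := hj; omega))
    (fun _ _ => rfl)

/-- The couplings-in-]0, 1] leaf of the carrier, read off `Flow.InInterval γ₁ K` with `γ₁ ≤ 1`. [folklore] -/
theorem carrier_smallCouplings {F : Flow} {γ₁ : ℝ} (hγ1 : γ₁ ≤ 1) (hI : F.InInterval γ₁ P.K) :
    (carrier I P F.g Efl).SmallCouplings := fun j hj =>
  ⟨(hI j (le_of_lt hj)).1, (hI j (le_of_lt hj)).2.trans hγ1⟩

/-- `ZLower (C_z^{SU}(N, ε₀))` HOLDS for the carrier of a run whose couplings lie in ]0, γ₁], γ₁ ≤ 1 — by the sibling's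
`B16ZLower.zLower_of_specialUnitaryGroup` (Laplace lower bound for the (0.15) normalisation on SU(N)). [folklore] -/
theorem carrier_zLower {F : Flow} {γ₁ : ℝ} (hγ1 : γ₁ ≤ 1) (hI : F.InInterval γ₁ P.K) :
    (carrier I P F.g Efl).ZLower (CzSU I.N I.ε₀) :=
  zLower_of_specialUnitaryGroup (carrier I P F.g Efl) I.N I.hε₀ (carrier_smallCouplings I P Efl hγ1 hI) rfl
    (fun _ _ => rfl)

/-- `EflBound C_E` for the carrier is literally the bound on the abstract family `Efl`. [folklore] -/
theorem carrier_eflBound_iff (CE : ℝ) :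
    (carrier I P g Efl).EflBound CE ↔ ∀ j, j < P.K → Efl j ≤ CE * sitesR I.L P (j + 1) := Iff.rfl

/-- `d(𝔰𝔲(N)) = N² − 1 ≥ 1` for `N ≥ 2`. [folklore] -/
theorem one_le_dg : 1 ≤ I.N * I.N - 1 := by
  have h := I.hN
  have : 4 ≤ I.N * I.N := Nat.mul_le_mul h h
  omega

/-- `0 ≤ 4|log σ₀| + C_z^{SU}(N, ε₀)` (`B16ZLower.CzSU_nonneg`). [folklore] -/
theorem constants_nonneg : 0 ≤ 4 * |I.logσ₀| + CzSU I.N I.ε₀ := by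
  have h1 : 0 ≤ CzSU I.N I.ε₀ := CzSU_nonneg I.hε₀
  positivity

/-- THE LATTICE-SIZE DICTIONARY CLAUSE gives `N 0 = |T₁^{(0)}|` for the carrier … [folklore] -/
theorem carrier_N_zero {C : B16.Construction} (hsites : (C P).numSites 0 = (2 * I.L ^ (P.m + P.K)) ^ 4) :
    (carrier I P g Efl).N 0 = ((C P).numSites 0 : ℝ) := by
  rw [hsites]
  show sitesR I.L P 0 = _
  rw [sitesR_eq_pow I P (Nat.zero_le _)]
  rfl

/-- … and non-empty lattices. [folklore] -/
theorem numSites_pos {C : B16.Construction} (hsites : (C P).numSites 0 = (2 * I.L ^ (P.m + P.K)) ^ 4) :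
    0 < ((C P).numSites 0 : ℝ) := by
  have hL : 0 < I.L := by have := I.hL; omega
  rw [hsites]
  positivity

end Discharge

/-! ## §4. Headline: ¬(B) from the flow clauses, the lattice-size clause, the Thm 1 normalisation leaf (E explicit)
and the open reader's item `EflBound` — every bookkeeping hypothesis discharged -/

/-- **The K₀ = 1 logarithm with explicit constants.**  For a `B16.Construction` whose step-0 lattices are the tori of
(0.1) and which, on the runs of the ]0, γ₁]-family (γ₁ ≤ 1) with at least one step, satisfies the Thm 1 p. 262
normalisation leaf `ρ₀(V₁) ≥ e^{−E}` (E = `leafE`, the explicit printed sum) at some configuration and the reader's item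
`E^{(j+1)}(T^{(j+1)}, g_j, 1) ≤ C_E|T₁^{(j+1)}|` (C_E ≥ 0, OPEN):
`LogNormalisedFrom C γ₁ (3(1 − L⁻⁴)(N² − 1)) (4|log σ₀| + C_z^{SU}(N, ε₀) + C_E/(L⁴ − 1)) 1`.
By `B16SmallCouplings.logNormalisedFrom_one_of_leaves` with §3. [cite: Balaban1988Convergent, Thm 1 p.262 and (1.15) p.249] -/
theorem logNormalisedFrom_one_of_torusLeaves (I : LeafInput) (C : B16.Construction)
    (hsites : ∀ P : B12.RunParams, (C P).numSites 0 = (2 * I.L ^ (P.m + P.K)) ^ 4)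
    {γ₁ : ℝ} (hγ1 : γ₁ ≤ 1) (Efl : B12.RunParams → ℕ → ℝ) {CE : ℝ} (hCE : 0 ≤ CE)
    (hE : ∀ P : B12.RunParams, 1 ≤ P.K → (C P).flow.InInterval γ₁ P.K →
      ∀ j, j < P.K → Efl P j ≤ CE * sitesR I.L P (j + 1))
    (hρ : ∀ P : B12.RunParams, 1 ≤ P.K → (C P).flow.InInterval γ₁ P.K →
      ∃ V₁ : (C P).Cfg 0, Real.exp (-(leafE I P (C P).flow.g (Efl P))) ≤ (C P).ρ 0 V₁) :
    LogNormalisedFrom C γ₁ (3 * (1 - 1 / (I.L : ℝ) ^ 4) * ((I.N * I.N - 1 : ℕ) : ℝ))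
      (4 * |I.logσ₀| + CzSU I.N I.ε₀ + CE / (((I.L : ℝ) ^ 4) - 1)) 1 :=
  logNormalisedFrom_one_of_leaves C hγ1 (leafFamily I C Efl) I.L (I.N * I.N - 1) I.logσ₀ (CzSU I.N I.ε₀) CE
    (fun _ => rfl) (fun _ => rfl) (fun _ => rfl) (fun _ => rfl)
    (fun P => carrier_N_zero I P _ _ (hsites P)) (fun _ _ _ => rfl)
    (fun P => carrier_oneStep115 I P _ _) (fun P => carrier_eSum I P _ _) (fun P => carrier_tstarCount I P _ _)
    (fun P => carrier_blocking I P _ _) (fun P j => carrier_N_nonneg I P _ _ j) hρ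
    (fun P _ hI => carrier_zLower I P (Efl P) hγ1 hI) (fun P hK hI => hE P hK hI) I.hL (constants_nonneg I) hCE

/-- **(B) REFUTED FROM LOCATED INPUTS ONLY, bookkeeping discharged.**  Let `G = SU(N)` (N ≥ 2), `L ≥ 2`, `ε₀ > 0`,
`log σ₀ ∈ ℝ` (`I : LeafInput`).  For every `B16.Construction` `C` that is (i) forward generated by (0.20) with a history
β-family bounded above on some box family ]0, γ₀]^{k+1} ([I] (0.17)–(0.20), p. 264; as in the sibling), (ii) whose
step-0 lattices are the tori of (0.1) [I], `|T₁^{(0)}| = (2L^{m+K})⁴`, and which on the runs of ONE ]0, γ₁]-family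
(0 < γ₁ ≤ 1) with at least one step satisfies (iii) the normalisation leaf of [III] Thm 1 p. 262 — some step-0
configuration V₁ has `ρ₀(V₁) ≥ e^{−E}`, `E = leafE` = the explicit sum over the scales of the (1.15) p. 249 constants
plus `E^{(j+1)}(T^{(j+1)}, g_j, 1)` (p. 254, p. 262) — and (iv) the reader's item `EflBound`:
`E^{(j+1)}(T^{(j+1)}, g_j, 1) ≤ C_E|T₁^{(j+1)}|` for j < K with `C_E ≥ 0` (OPEN, author question (ii) of cell GAPS
G-pv24-1: no printed statement bounds this constant) — the constant-exponent reading (B) `B16.UVBound01 C` of B16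
(0.1) is FALSE.  All other hypotheses of `B16SmallCouplings.not_uvBound01_of_leaves` are discharged by §1–§3.
Nothing printed asserted; NOT a claim about Bałaban's densities until (iii) and (iv) are settled. [cite: Balaban1989LargeFieldII, (0.1) pp.355–356] -/
theorem not_uvBound01_of_torusLeaves (I : LeafInput) (C : B16.Construction) {β : HBeta}
    (hgen : ForwardGenerated C.toB12 β) {γ₀ β' : ℝ} (hγ₀ : 0 < γ₀) (hβ' : 0 ≤ β') (hup : BetaUpperH β' γ₀ β)
    (hsites : ∀ P : B12.RunParams, (C P).numSites 0 = (2 * I.L ^ (P.m + P.K)) ^ 4)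
    {γ₁ : ℝ} (hγ₁ : 0 < γ₁) (hγ1 : γ₁ ≤ 1) (Efl : B12.RunParams → ℕ → ℝ) {CE : ℝ} (hCE : 0 ≤ CE)
    (hE : ∀ P : B12.RunParams, 1 ≤ P.K → (C P).flow.InInterval γ₁ P.K →
      ∀ j, j < P.K → Efl P j ≤ CE * sitesR I.L P (j + 1))
    (hρ : ∀ P : B12.RunParams, 1 ≤ P.K → (C P).flow.InInterval γ₁ P.K →
      ∃ V₁ : (C P).Cfg 0, Real.exp (-(leafE I P (C P).flow.g (Efl P))) ≤ (C P).ρ 0 V₁) :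
    ¬ B16.UVBound01 C :=
  not_uvBound01_of_leaves C hgen hγ₀ hβ' hup (fun P => numSites_pos I P (hsites P)) hγ₁ hγ1
    (leafFamily I C Efl) I.L (I.N * I.N - 1) I.logσ₀ (CzSU I.N I.ε₀) CE
    (fun _ => rfl) (fun _ => rfl) (fun _ => rfl) (fun _ => rfl)
    (fun P => carrier_N_zero I P _ _ (hsites P)) (fun _ _ _ => rfl)
    (fun P => carrier_oneStep115 I P _ _) (fun P => carrier_eSum I P _ _) (fun P => carrier_tstarCount I P _ _)
    (fun P => carrier_blocking I P _ _) (fun P j => carrier_N_nonneg I P _ _ j) hρ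
    (fun P _ hI => carrier_zLower I P (Efl P) hγ1 hI) (fun P hK hI => hE P hK hI) I.hL (one_le_dg I)
    (constants_nonneg I) hCE

/-- The slope of the logarithm is positive: `3(1 − L⁻⁴)(N² − 1) > 0` (for SU(2), L = 2: `135/16`). [folklore] -/
theorem torusLeaves_slope_pos (I : LeafInput) : 0 < 3 * (1 - 1 / (I.L : ℝ) ^ 4) * ((I.N * I.N - 1 : ℕ) : ℝ) :=
  B16SmallCouplings.leaves_slope_pos I.hL (one_le_dg I)

/-! ## §5. Non-vacuity: a toy construction satisfying every hypothesis of the headline at once -/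

/-- TOY construction (a model of the carriers, not a claim about the series): couplings generated forward by (0.20)
from the bare coupling with the history family `β` (`FlowStepRuns.genFlow`, as in `B16SmallCouplings.toyModel`); the
lattice numbers of (0.1); one configuration per scale; densities `ρ_k ≡ e^{−E}` with `E = leafE` of the generated
couplings; all other data trivial. [folklore] -/
noncomputable def toyTorus (I : LeafInput) (β : HBeta) (Efl : B12.RunParams → ℕ → ℝ) : B16.Construction := fun P =>
  { flow := genFlow β P.g0
    Cfg := fun _ => Unit
    dom := fun _ => Set.univ
    effAction := fun _ _ => 0
    wilsonBG := fun _ _ => 0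
    Ek := fun _ _ => 0
    numSites := fun j => (2 * I.L ^ (P.m + P.K - j)) ^ 4
    Repr := fun _ => True
    IndAss := fun _ => True
    ρ := fun _ _ => Real.exp (-(leafE I P (genSeq β P.g0) (Efl P)))
    χ := fun _ _ => 0
    Sect2Form := fun _ => True }

/-- The toy is forward-generated by (0.20) with `β` (same computation as `B16SmallCouplings.toyModel_forwardGenerated`).
[folklore] -/
theorem toyTorus_forwardGenerated (I : LeafInput) (β : HBeta) (Efl : B12.RunParams → ℕ → ℝ) :
    ForwardGenerated (toyTorus I β Efl).toB12 β := by
  refine ⟨fun P => genSeq_zero β P.g0, fun P k _ _ hrhs => ?_⟩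
  show 0 < genSeq β P.g0 (k + 1) ∧
    1 / (genSeq β P.g0 (k + 1)) ^ 2 = 1 / (genSeq β P.g0 k) ^ 2 - β k (prefixOf (genSeq β P.g0) k)
  rw [genSeq_succ]
  exact ⟨solveCoupling_pos hrhs, inv_sq_solveCoupling hrhs⟩

/-- With the ZERO β-family, `Efl ≡ 0` and `C_E = 0`, EVERY hypothesis of `not_uvBound01_of_torusLeaves` holds for the
toy (at γ₀ = γ₁ = 1, β′ = 0) — forward generation, the upper β-bound, the lattice-size clause, the `EflBound` clause
and the normalisation leaf (with equality) — and so does its conclusion: the instantiated theorem is not vacuous.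
[folklore] -/
theorem toyTorus_headline_hypotheses (I : LeafInput) :
    let β : HBeta := fun _ _ => 0
    let Efl : B12.RunParams → ℕ → ℝ := fun _ _ => 0
    ForwardGenerated (toyTorus I β Efl).toB12 β ∧ BetaUpperH 0 1 β ∧
    (∀ P : B12.RunParams, ((toyTorus I β Efl) P).numSites 0 = (2 * I.L ^ (P.m + P.K)) ^ 4) ∧
    (∀ P : B12.RunParams, 1 ≤ P.K → ((toyTorus I β Efl) P).flow.InInterval 1 P.K →
      ∀ j, j < P.K → Efl P j ≤ 0 * sitesR I.L P (j + 1)) ∧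
    (∀ P : B12.RunParams, 1 ≤ P.K → ((toyTorus I β Efl) P).flow.InInterval 1 P.K →
      ∃ V₁ : ((toyTorus I β Efl) P).Cfg 0,
        Real.exp (-(leafE I P ((toyTorus I β Efl) P).flow.g (Efl P))) ≤ ((toyTorus I β Efl) P).ρ 0 V₁) ∧
    ¬ B16.UVBound01 (toyTorus I β Efl) := by
  intro β Efl
  have hgen := toyTorus_forwardGenerated I β Efl
  have hup : BetaUpperH 0 1 β := fun _ _ _ => le_rfl
  have hsites : ∀ P : B12.RunParams, ((toyTorus I β Efl) P).numSites 0 = (2 * I.L ^ (P.m + P.K)) ^ 4 :=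
    fun P => by show (2 * I.L ^ (P.m + P.K - 0)) ^ 4 = _; rw [Nat.sub_zero]
  have hE : ∀ P : B12.RunParams, 1 ≤ P.K → ((toyTorus I β Efl) P).flow.InInterval 1 P.K →
      ∀ j, j < P.K → Efl P j ≤ 0 * sitesR I.L P (j + 1) := fun P _ _ j _ => by
    show (0 : ℝ) ≤ 0 * sitesR I.L P (j + 1)
    rw [zero_mul]
  have hρ : ∀ P : B12.RunParams, 1 ≤ P.K → ((toyTorus I β Efl) P).flow.InInterval 1 P.K →
      ∃ V₁ : ((toyTorus I β Efl) P).Cfg 0,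
        Real.exp (-(leafE I P ((toyTorus I β Efl) P).flow.g (Efl P))) ≤ ((toyTorus I β Efl) P).ρ 0 V₁ :=
    fun P _ _ => ⟨(), le_rfl⟩
  exact ⟨hgen, hup, hsites, hE, hρ,
    not_uvBound01_of_torusLeaves I _ hgen one_pos le_rfl hup hsites one_pos le_rfl Efl le_rfl hE hρ⟩

end B16LeafFamily

end Literature.MathematicalPhysics.QuantumFieldTheory.Balaban1983to89
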